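import Summits.BirchSwinnertonDyer.BirchSwinnertonDyer.Theorems.ClassRecordThreeCornerAtThreeControlOfFacts
import Summits.BirchSwinnertonDyer.BirchSwinnertonDyer.Theorems.ClassRecordThreeCornerAtThreeCoChainDefs
import Summits.BirchSwinnertonDyer.Rank1Residual.X11b.Three.TamagawaAdditiveThree
import Summits.BirchSwinnertonDyer.Rank1Residual.X11b.Three.JetchevShapeOverK
import Summits.BirchSwinnertonDyer.Rank1Residual.X11b.TwistTransportRam
import Summits.BirchSwinnertonDyer.Rank1Residual.X11b.TwistTransportIrr
import Summits.BirchSwinnertonDyer.Rank1Residual.X2.TwistTamagawa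
import Literature.NumberTheory.EllipticCurves.Rank1Residual.X9NoEntry
import Summits.BirchSwinnertonDyer.BirchSwinnertonDyer.Theses.ClassRecordThree
import Summits.BirchSwinnertonDyer.BirchSwinnertonDyer.Theses.KolyvaginRoadThree
import HarnessLib

/-!
# Route `ClassRecordThree` (rung K2@3), crux 5 `EulerHalvesAtThree` (item stmt-BirchSwinnertonDyer-19109, shared by
# `KolyvaginRoadThree`): the CO-CHAIN road on the SURJECTIVE loci — (T2′)₃ with FULL Tamagawa depth from the
# Kolyvagin-system («⊇») half of the anticyclotomic BDP main conjecture at `𝟙` + the control identity (facts-only),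
# in place of {J₃ʳ, J₃⁰} (cell `bsd-stepL`, width-lever second lane `bsd-stepL-corner3-p2`, OFFER to the 19109 hands;
# `--supports stmt-BirchSwinnertonDyer-19109 --as helper`)

HONEST FRAMING: theorems only (no definition, no named fact, no `sorry`); CONDITIONAL on cited Literature facts taken
BY NAME and on OPEN inputs stated inline (hypothesis shape, nothing asserted); nothing is asserted about any curve;
item 19109 stays open; BSD is not advanced; no census word, tier or label moves (T7).

## Why (tam3-p1's `…EulerHalvesAtThreeJetchevMax.lean`, verbatim): «J₃ at a frame asks `3^s`-divisibility of every
## derived Heegner point to depth `t = ord₃ ∏_ℓ c_ℓ(E)` — the SUM of the local exponents. Jetchev's printed method (and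
## every Kolyvagin-system method in print …) yields the MAXIMUM `max_q ord₃ c_q` only; the sum is known in print only
## through an anticyclotomic main conjecture (BCGS arXiv:2312.09301 Thm. 2, good ordinary `p > 3`).»

This file is that main-conjecture road IN THE KERNEL at `p = 3 ∥ N`: the sharp `K`-bound with the FULL Tamagawa term
`ord₃ #Ш(E/K) + 2·ord₃ ∏_ℓ c_ℓ(E) ≤ 2·ord₃ [E(K):ℤP]` follows at every surj Heegner frame from
(co-IMC) the «⊇» half at `𝟙` — `X11b.IMCUpperWaldspurgerOnTreeAt 3 κ 𝔭 γ embAt P` (`ord₃ f_ac(0) ≤ 2(ord₃ log_ω P − 1)` on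
Castella's constructed `X_ac`; `Theorems/ClassRecordThreeCornerAtThreeCoChainDefs.lean`, p530129) — and the anticyclotomic
CONTROL identity, which is a THEOREM at every multiplicative rank-one datum modulo four cited facts
(`X11b.controlOnTreeAt_of_mult_of_rankOne_odd`, p528380; the Tamagawa term `∏_{w∣N⁺} c_w = (∏_ℓ c_ℓ)²` enters there
EXACTLY — no mono∕multi-carrier split, no McCallum Cor. 5.6, no conductor-1 datum). The open input CoS₃ below is
`Three.StepLAt W` (x11b3's S0-currency STEP L on surj frames) with the conclusion's inequality REVERSED — the twin the
corner lane named `Three.CornerCoStepLAt` on the ¬Surj corner.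

* `Koly.missingUpperBoundAt_three_of_classX11b_of_ram_of_coStepL` — X11b ∧ (ram) (every Tamagawa shape: the (α) and
  (γ∖α) clauses): `Typed.MissingUpperBoundAt W 3` ⟸ CoS₃ + published facts (Gross–Zagier, Kolyvagin, Skinner 2016 Thm. C
  for the twist, GZK, modularity ×2, Hoffstein–Luo, Mazur's Manin bound) + the control facts (Poitou–Tate ×2); descent to
  `ℚ` by x11b3's `missingUpperBoundAt_of_sharpIndexBound_of_le`.
* `Koly.missingUpperBoundAt_three_of_classX11b_of_surj_of_not_ram_of_coStepL_of_twistLower` — X11b ∧ surj ∧ ¬(ram):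
  the same with TL₃ (tam3's twist-lower binder, verbatim) in place of Skinner Thm. C, via
  `missingUpperBoundAt_of_shaIndexBound_sharp`.
* **`Koly.classRecordThree_eulerHalvesAtThree_of_coStepL_of_twistLower`** (+ the `KolyvaginRoadThree` twin): the crux BY
  NAME from the published ∕ cited facts and EXACTLY two open inputs {CoS₃, TL₃} — versus tam3's {J₃ʳ, J₃⁰, TL₃} ∕
  {`JetchevMaxHL`, J₃-multi ×2, TL₃}. CoS₃ is IMC-grade (nothing in print at `p = 3`; at good ordinary `p > 3` with (sur)
  it is Howard 2004 Thm. B ∕ BCK21 ∕ BCS24); it is offered as the typed home of the «sum» residue of 19109.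

References: [Castella2018] Thm. 2.3, Thm. 3.2 (arXiv:1704.06608 pp. 5, 9); [JetchevSkinnerWan2017] Thm. 3.3.1, §7.4.2
(eq:shaupper); [Howard2004] Thm. B (shape); [BCGS2023] arXiv:2312.09301 Thm. 2; [Skinner2016PacificMC] Thm. C;
[Miller2011LMS] Def. 1.1; tree `Theorems/ClassRecordThreeEulerHalvesAtThreeJetchev{,NotRam,Max}.lean` (tam3-p1).
-/

noncomputable section

open scoped Classical

namespace Summit.BirchSwinnertonDyer.Rank1Residual.X11b.Three.Koly

open WeierstrassCurve NumberField IsDedekindDomain Field Literature.NumberTheory.EllipticCurves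
  Literature.NumberTheory.EllipticCurves.ModularForms Literature.NumberTheory.GaloisCohomology
  Literature.NumberTheory.EllipticCurves.Rank1Residual Literature.NumberTheory.EllipticCurves.Rank1Residual.Typed
  Literature.NumberTheory.QuadraticFields.Quadratic
  Summit.BirchSwinnertonDyer.Rank1Residual Summit.BirchSwinnertonDyer.Rank1Residual.X11b
  Summit.BirchSwinnertonDyer.Rank1Residual.X11b.AcSelmer

/-! ### §1 The sharp `K`-bound at a surj Heegner frame from CoS₃ + control -/

/-- **The Tamagawa-SHARP bound over `K` at an odd Heegner frame of a SURJECTIVE X11b pair, from CoS₃ and the facts-only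
control identity** — the `hU` ∕ `hJ` binder of x11b3's `missingUpperBoundAt_of_sharpIndexBound_of_le` ∕
`missingUpperBoundAt_of_shaIndexBound_sharp` with weight `ord₃ ∏_ℓ c_ℓ(E)` (FULL depth). `(κ, γ, 𝔭)` exist by
`exists_anticyclotomic_generator_prime`; `𝔭` has degree one since `3 ∣ N_E` splits in `K`.
[cite: JetchevSkinnerWan2017, §7.4.2 (eq:shaupper) (arXiv:1512.06894 p. 31)] [cite: Castella2018, Thm. 2.3 (p. 5), Thm. 3.2 (p. 9)] -/
theorem sharpIndexBound_three_of_coStepL_of_facts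
    (hGZK : rank_eq_analyticRank_of_analyticRank_le_one) (hnf : exists_isNewformOf)
    (hPT : ∀ (K : Type) [Field K] [NumberField K], poitouTate_selmerStructure_duality K)
    (hPT2 : ∀ (K : Type) [Field K] [NumberField K], poitouTate_sha_tateDual K)
    -- OPEN INPUT CoS₃: the «⊇» half at 𝟙 on surj frames (= `Three.StepLAt` with the inequality reversed)
    (hco : ∀ (W : WeierstrassCurve ℚ) [W.IsElliptic] [W.IsGloballyMinimal]
      (N : ℕ) [NeZero N] (K : Type) [Field K] [NumberField K]
      (Dt : ModularParametrizationData W N) (H : HeegnerDatum N (NumberField.discr K)) (ι : K →+* ℂ)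
      (P : (W.baseChange K).toAffine.Point),
      ClassX11b W 3 → Surj W 3 → W.conductorNorm ℤ = N → IsImaginaryQuadratic K →
      Odd (NumberField.discr K) → SatisfiesHeegnerHypothesis N K →
      (W.quadraticTwist (NumberField.discr K : ℚ)).entireLFunction 1 ≠ 0 →
      WeierstrassCurve.Affine.Point.map ι.toRatAlgHom P = heegnerPointComplex Dt H →
      ¬ (3 : ℤ) ∣ Dt.c → ¬ IsOfFinAddOrder P →
      ∀ (κ : ZpExtension K 3), κ.IsAnticyclotomic →
        ∀ (γ : Field.absoluteGaloisGroup K) [Fact (κ.IsTopGenerator γ)]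
          (𝔭 : HeightOneSpectrum (𝓞 K)) (h𝔭 : ((3 : ℕ) : 𝓞 K) ∈ 𝔭.asIdeal)
          (he : 𝔭.asIdeal.ramificationIdx (𝓞 ℚ) = 1) (hf : 𝔭.asIdeal.inertiaDeg (𝓞 ℚ) = 1),
          IMCUpperWaldspurgerOnTreeAt 3 κ 𝔭 γ (embAt K 3 𝔭 h𝔭 he hf) P)
    (W : WeierstrassCurve ℚ) [W.IsElliptic] [W.IsGloballyMinimal] [NeZero (W.conductorNorm ℤ)]
    (hX : ClassX11b W 3) (hρ : Surj W 3)
    (K : Type) [Field K] [NumberField K] (Dt : ModularParametrizationData W (W.conductorNorm ℤ))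
    (H : HeegnerDatum (W.conductorNorm ℤ) (NumberField.discr K)) (ι : K →+* ℂ) (P : (W.baseChange K).toAffine.Point)
    (hK : IsImaginaryQuadratic K) (hodd : Odd (NumberField.discr K))
    (hHN : SatisfiesHeegnerHypothesis (W.conductorNorm ℤ) K)
    (hLt : (W.quadraticTwist (NumberField.discr K : ℚ)).entireLFunction 1 ≠ 0)
    (hP : WeierstrassCurve.Affine.Point.map ι.toRatAlgHom P = heegnerPointComplex Dt H)
    (hc : ¬ (3 : ℤ) ∣ Dt.c) :
    Finite (W.baseChange K).sha → ¬ IsOfFinAddOrder P →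
      padicValNat 3 (Nat.card (W.baseChange K).sha) + 2 * padicValNat 3 W.tamagawaProduct ≤
        2 * padicValNat 3 (AddSubgroup.zmultiples P).index := by
  intro hfin hPinf
  haveI := hfin
  obtain ⟨hr, h32, hmult, -⟩ := id hX
  have hsplit : SplitsIn K 3 := hHN 3 Fact.out (dvd_conductorNorm_of_mult hmult)
  obtain ⟨κ, γ, 𝔭, hκ, hγ, h𝔭⟩ := exists_anticyclotomic_generator_prime (p := 3) hK
  haveI : Fact (κ.IsTopGenerator γ) := ⟨hγ⟩
  obtain ⟨he, hf⟩ := degreeOne_of_splitsIn hK.1 hsplit h𝔭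
  have hCTL : ControlOnTreeAt 3 κ 𝔭 γ (embAt K 3 𝔭 h𝔭 he hf) P :=
    controlOnTreeAt_of_mult_of_rankOne_odd W 3 hGZK hnf hPT hPT2 h32 hmult hr hK hsplit hLt P hPinf κ hκ γ 𝔭 h𝔭
      he hf
  have h := shaOrder_add_two_mul_tamagawa_le_of_coLinks (p := 3) hK rfl hHN
    (hco W (W.conductorNorm ℤ) K Dt H ι P hX hρ rfl hK hodd hHN hLt hP hc hPinf κ hκ γ 𝔭 h𝔭 he hf) hCTL
  rwa [WeierstrassCurve.shaOrder] at h

/-! ### §2 Class level: X11b ∧ (ram) — the (α) and (γ∖α) clauses -/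

/-- **The Euler-system half of `BSD(E,3)` on X11b ∧ (ram) — every Tamagawa shape — from CoS₃.** For every `(E,3)` in
class X11b with a (ram) witness (hence `ρ̄_{E,3}` onto, `surj_of_irr_of_ram`): `Typed.MissingUpperBoundAt W 3`.
Inputs: the published facts `hGZ`, `hKo`, `hSk` (Skinner Thm. C for the twist, (ram) inherited), `hGZK`, `hmod`, `hnf`,
`hHL`, `hMaz`; the cited control facts `hPT`, `hPT2`; and ONE open input CoS₃ (`hco`). Proof: the odd Hoffstein–Luo
Heegner datum of the pair (`exists_oddHeegnerData`), §1 with weight `ord₃ ∏_ℓ c_ℓ(E)`, then x11b3's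
`missingUpperBoundAt_of_sharpIndexBound_of_le`. No conductor-1 datum, no McCallum, no mono∕multi split.
[cite: JetchevSkinnerWan2017, §7.4.2 (p. 31)] [cite: Skinner2016PacificMC, Thm. C (§1) and footnote 1] [cite: Miller2011LMS, Def. 1.1] -/
theorem missingUpperBoundAt_three_of_classX11b_of_ram_of_coStepL
    (hGZ : ∀ (N : ℕ) [NeZero N] (W : WeierstrassCurve ℚ) (K : Type) [Field K] [NumberField K],
      gross_zagier N W K)
    (hKo : ∀ (N : ℕ) [NeZero N] (W : WeierstrassCurve ℚ) (K : Type) [Field K] [NumberField K],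
      kolyvagin N W K)
    (hSk : Skinner2016.thmC_padicValRat_bsd_rank_zero)
    (hGZK : rank_eq_analyticRank_of_analyticRank_le_one) (hmod : hasEntireLFunction_rat)
    (hnf : exists_isNewformOf) (hHL : HoffsteinLuo1997_exists_twist_L_one_ne_zero)
    (hMaz : mazur_not_dvd_maninConstant_of_odd)
    (hPT : ∀ (K : Type) [Field K] [NumberField K], poitouTate_selmerStructure_duality K)
    (hPT2 : ∀ (K : Type) [Field K] [NumberField K], poitouTate_sha_tateDual K)
    (hco : ∀ (W : WeierstrassCurve ℚ) [W.IsElliptic] [W.IsGloballyMinimal]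
      (N : ℕ) [NeZero N] (K : Type) [Field K] [NumberField K]
      (Dt : ModularParametrizationData W N) (H : HeegnerDatum N (NumberField.discr K)) (ι : K →+* ℂ)
      (P : (W.baseChange K).toAffine.Point),
      ClassX11b W 3 → Surj W 3 → W.conductorNorm ℤ = N → IsImaginaryQuadratic K →
      Odd (NumberField.discr K) → SatisfiesHeegnerHypothesis N K →
      (W.quadraticTwist (NumberField.discr K : ℚ)).entireLFunction 1 ≠ 0 →
      WeierstrassCurve.Affine.Point.map ι.toRatAlgHom P = heegnerPointComplex Dt H →
      ¬ (3 : ℤ) ∣ Dt.c → ¬ IsOfFinAddOrder P →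
      ∀ (κ : ZpExtension K 3), κ.IsAnticyclotomic →
        ∀ (γ : Field.absoluteGaloisGroup K) [Fact (κ.IsTopGenerator γ)]
          (𝔭 : HeightOneSpectrum (𝓞 K)) (h𝔭 : ((3 : ℕ) : 𝓞 K) ∈ 𝔭.asIdeal)
          (he : 𝔭.asIdeal.ramificationIdx (𝓞 ℚ) = 1) (hf : 𝔭.asIdeal.inertiaDeg (𝓞 ℚ) = 1),
          IMCUpperWaldspurgerOnTreeAt 3 κ 𝔭 γ (embAt K 3 𝔭 h𝔭 he hf) P)
    (W : WeierstrassCurve ℚ) [W.IsElliptic] [W.IsGloballyMinimal]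
    (hX : ClassX11b W 3) (hram : Ram W 3) : Typed.MissingUpperBoundAt W 3 := by
  haveI : NeZero (W.conductorNorm ℤ) := ⟨(W.conductorNorm_pos_holds).ne'⟩
  obtain ⟨hr, h32, hmult, hirr⟩ := id hX
  have hρ : Surj W 3 := surj_of_irr_of_ram W 3 hirr hram
  obtain ⟨K, _, _, Dt, H, ι, P, Wd, _, _, Cd, hK, hodd, h3d, hHN, hP, hc, hμ, hLt, hWd⟩ :=
    exists_oddHeegnerData hnf hHL hMaz integral_neronScaling_of_isGloballyMinimal_holds W 3 hr h32
      hmult hirr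
  exact missingUpperBoundAt_of_sharpIndexBound_of_le W 3 K Dt H ι P (hGZ _ W K) (hKo _ W K) hSk hGZK
    hmod hr h32 hmult hirr hram hK hodd h3d hHN hP hc hμ hLt Wd Cd hWd (padicValNat 3 W.tamagawaProduct)
    le_rfl (sharpIndexBound_three_of_coStepL_of_facts hGZK hnf hPT hPT2 hco W hX hρ K Dt H ι P hK hodd hHN hLt hP hc)

/-! ### §3 Class level: X11b ∧ surj ∧ ¬(ram), with the twist's lower bound TL₃ -/

/-- **The Euler-system half on X11b ∧ surj ∧ ¬(ram) from CoS₃ and TL₃** (tam3's twist-lower binder verbatim; Skinner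
Thm. C is void without (ram)). As tam3's `…_of_jetchevDivisibility_of_twistLower` with §1 in place of J₃⁰ + McCallum.
[cite: JetchevSkinnerWan2017, §7.4.2 (p. 31)] [cite: Skinner2016PacificMC, Thm. C (§1) — shape of TL₃ only] [cite: Miller2011LMS, Def. 1.1] -/
theorem missingUpperBoundAt_three_of_classX11b_of_surj_of_not_ram_of_coStepL_of_twistLower
    (hGZ : ∀ (N : ℕ) [NeZero N] (W : WeierstrassCurve ℚ) (K : Type) [Field K] [NumberField K],
      gross_zagier N W K)
    (hKo : ∀ (N : ℕ) [NeZero N] (W : WeierstrassCurve ℚ) (K : Type) [Field K] [NumberField K],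
      kolyvagin N W K)
    (hGZK : rank_eq_analyticRank_of_analyticRank_le_one) (hmod : hasEntireLFunction_rat)
    (hnf : exists_isNewformOf) (hHL : HoffsteinLuo1997_exists_twist_L_one_ne_zero)
    (hMaz : mazur_not_dvd_maninConstant_of_odd)
    (hPT : ∀ (K : Type) [Field K] [NumberField K], poitouTate_selmerStructure_duality K)
    (hPT2 : ∀ (K : Type) [Field K] [NumberField K], poitouTate_sha_tateDual K)
    (hco : ∀ (W : WeierstrassCurve ℚ) [W.IsElliptic] [W.IsGloballyMinimal]
      (N : ℕ) [NeZero N] (K : Type) [Field K] [NumberField K]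
      (Dt : ModularParametrizationData W N) (H : HeegnerDatum N (NumberField.discr K)) (ι : K →+* ℂ)
      (P : (W.baseChange K).toAffine.Point),
      ClassX11b W 3 → Surj W 3 → W.conductorNorm ℤ = N → IsImaginaryQuadratic K →
      Odd (NumberField.discr K) → SatisfiesHeegnerHypothesis N K →
      (W.quadraticTwist (NumberField.discr K : ℚ)).entireLFunction 1 ≠ 0 →
      WeierstrassCurve.Affine.Point.map ι.toRatAlgHom P = heegnerPointComplex Dt H →
      ¬ (3 : ℤ) ∣ Dt.c → ¬ IsOfFinAddOrder P →
      ∀ (κ : ZpExtension K 3), κ.IsAnticyclotomic →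
        ∀ (γ : Field.absoluteGaloisGroup K) [Fact (κ.IsTopGenerator γ)]
          (𝔭 : HeightOneSpectrum (𝓞 K)) (h𝔭 : ((3 : ℕ) : 𝓞 K) ∈ 𝔭.asIdeal)
          (he : 𝔭.asIdeal.ramificationIdx (𝓞 ℚ) = 1) (hf : 𝔭.asIdeal.inertiaDeg (𝓞 ℚ) = 1),
          IMCUpperWaldspurgerOnTreeAt 3 κ 𝔭 γ (embAt K 3 𝔭 h𝔭 he hf) P)
    (hTL : ∀ (V : WeierstrassCurve ℚ) [V.IsElliptic] [V.IsGloballyMinimal],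
      V.HasMultiplicativeReductionAtPrime 3 → V.HasIrreducibleModPGaloisRep 3 →
      V.entireLFunction 1 ≠ 0 → Finite V.sha →
      ∃ q : ℚ, V.entireLFunction 1 / (V.realPeriodRat : ℂ) = (q : ℂ) ∧
        padicValRat 3 q ≤ (padicValNat 3 V.shaOrder : ℤ) + padicValNat 3 V.tamagawaProduct -
          2 * padicValNat 3 V.torsionOrder)
    (W : WeierstrassCurve ℚ) [W.IsElliptic] [W.IsGloballyMinimal]
    (hX : ClassX11b W 3) (hρ : Surj W 3) : Typed.MissingUpperBoundAt W 3 := by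
  haveI : NeZero (W.conductorNorm ℤ) := ⟨(W.conductorNorm_pos_holds).ne'⟩
  obtain ⟨hr, h32, hmult, hirr⟩ := id hX
  obtain ⟨K, _, _, Dt, H, ι, P, Wd, _, _, Cd, hK, hodd, h3d, hHN, hP, hc, hμ, hLt, hWd⟩ :=
    exists_oddHeegnerData hnf hHL hMaz integral_neronScaling_of_isGloballyMinimal_holds W 3 hr h32
      hmult hirr
  have hU := sharpIndexBound_three_of_coStepL_of_facts hGZK hnf hPT hPT2 hco W hX hρ K Dt H ι P hK hodd hHN hLt hP
    hc
  -- the twist: transports (no (ram) needed) and TL₃ at its minimal model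
  have hD0 : (NumberField.discr K : ℚ) ≠ 0 := by exact_mod_cast NumberField.discr_ne_zero K
  haveI hEt : (W.quadraticTwist (NumberField.discr K : ℚ)).IsElliptic :=
    W.isElliptic_quadraticTwist hD0
  have hmultd : Wd.HasMultiplicativeReductionAtPrime 3 :=
    hasMultiplicativeReductionAtPrime_twist_of_heegner' W 3 K hK hHN hmult Cd hWd
  have hirrd : Wd.HasIrreducibleModPGaloisRep 3 :=
    hasIrreducibleModPGaloisRep_twist_model W 3 K hK.1 hirr Cd hWd
  have htam : padicValNat 3 Wd.tamagawaProduct = padicValNat 3 W.tamagawaProduct :=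
    X2.padicValNat_tamagawaProduct_twist_of_heegner_of_odd W 3 h32 K hK hodd h3d hHN Cd hWd
  have hu : padicValRat 3 (Cd.u : ℚ) = 0 :=
    padicValRat_u_eq_zero_of_twist_minimal W 3 K hK hHN hmult Cd hWd
  have hLt' : (W.quadraticTwist (NumberField.discr K : ℚ)).entireLFunction = Wd.entireLFunction := by
    rw [← hWd, entireLFunction_smul]
  have hLd1 : Wd.entireLFunction 1 ≠ 0 := by rw [← hLt']; exact hLt
  have hfinSd : Finite Wd.sha := (hGZK Wd (by
    rw [(Wd.analyticRank_eq_zero_iff_holds (hmod Wd)).2 hLd1]; omega)).2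
  obtain ⟨qd, hqd, hvqd⟩ := hTL Wd hmultd hirrd hLd1 hfinSd
  exact missingUpperBoundAt_of_shaIndexBound_sharp W 3 (W.conductorNorm ℤ) K Dt H ι P (hGZ _ W K)
    (hKo _ W K) hGZK hmod hK hHN hP h32 hc hμ hr hLt Wd Cd hWd hu htam le_rfl ⟨qd, hqd, hvqd⟩ hU

/-! ### §4 The crux BY NAME modulo exactly {CoS₃, TL₃} and the published ∕ cited facts -/

/-- **Item 19109 `EulerHalvesAtThree` (route `ClassRecordThree`, crux 5) from the published ∕ cited facts and EXACTLY
TWO open inputs: CoS₃ (the «⊇» half of the anticyclotomic BDP main conjecture at `𝟙` on surj Heegner frames) and TL₃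
(the rank-`0` `3`-part lower bound for the twist without (ram)).** Clauses (α), (γ∖α) by §2, surj ∧ ¬(ram) by §3.
CONDITIONAL on every binder; the item does NOT close by this theorem; nothing booked.
[cite: JetchevSkinnerWan2017, §7.4.2 (p. 31)] [cite: Castella2018, Thm. 2.3 (p. 5), Thm. 3.2 (p. 9)] [cite: Skinner2016PacificMC, Thm. C (§1)] -/
theorem classRecordThree_eulerHalvesAtThree_of_coStepL_of_twistLower
    (hGZ : ∀ (N : ℕ) [NeZero N] (W : WeierstrassCurve ℚ) (K : Type) [Field K] [NumberField K],
      gross_zagier N W K)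
    (hKo : ∀ (N : ℕ) [NeZero N] (W : WeierstrassCurve ℚ) (K : Type) [Field K] [NumberField K],
      kolyvagin N W K)
    (hSk : Skinner2016.thmC_padicValRat_bsd_rank_zero)
    (hGZK : rank_eq_analyticRank_of_analyticRank_le_one) (hmod : hasEntireLFunction_rat)
    (hnf : exists_isNewformOf) (hHL : HoffsteinLuo1997_exists_twist_L_one_ne_zero)
    (hMaz : mazur_not_dvd_maninConstant_of_odd)
    (hPT : ∀ (K : Type) [Field K] [NumberField K], poitouTate_selmerStructure_duality K)
    (hPT2 : ∀ (K : Type) [Field K] [NumberField K], poitouTate_sha_tateDual K)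
    -- OPEN INPUT CoS₃
    (hco : ∀ (W : WeierstrassCurve ℚ) [W.IsElliptic] [W.IsGloballyMinimal]
      (N : ℕ) [NeZero N] (K : Type) [Field K] [NumberField K]
      (Dt : ModularParametrizationData W N) (H : HeegnerDatum N (NumberField.discr K)) (ι : K →+* ℂ)
      (P : (W.baseChange K).toAffine.Point),
      ClassX11b W 3 → Surj W 3 → W.conductorNorm ℤ = N → IsImaginaryQuadratic K →
      Odd (NumberField.discr K) → SatisfiesHeegnerHypothesis N K →
      (W.quadraticTwist (NumberField.discr K : ℚ)).entireLFunction 1 ≠ 0 →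
      WeierstrassCurve.Affine.Point.map ι.toRatAlgHom P = heegnerPointComplex Dt H →
      ¬ (3 : ℤ) ∣ Dt.c → ¬ IsOfFinAddOrder P →
      ∀ (κ : ZpExtension K 3), κ.IsAnticyclotomic →
        ∀ (γ : Field.absoluteGaloisGroup K) [Fact (κ.IsTopGenerator γ)]
          (𝔭 : HeightOneSpectrum (𝓞 K)) (h𝔭 : ((3 : ℕ) : 𝓞 K) ∈ 𝔭.asIdeal)
          (he : 𝔭.asIdeal.ramificationIdx (𝓞 ℚ) = 1) (hf : 𝔭.asIdeal.inertiaDeg (𝓞 ℚ) = 1),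
          IMCUpperWaldspurgerOnTreeAt 3 κ 𝔭 γ (embAt K 3 𝔭 h𝔭 he hf) P)
    -- OPEN INPUT TL₃
    (hTL : ∀ (V : WeierstrassCurve ℚ) [V.IsElliptic] [V.IsGloballyMinimal],
      V.HasMultiplicativeReductionAtPrime 3 → V.HasIrreducibleModPGaloisRep 3 →
      V.entireLFunction 1 ≠ 0 → Finite V.sha →
      ∃ q : ℚ, V.entireLFunction 1 / (V.realPeriodRat : ℂ) = (q : ℂ) ∧
        padicValRat 3 q ≤ (padicValNat 3 V.shaOrder : ℤ) + padicValNat 3 V.tamagawaProduct -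
          2 * padicValNat 3 V.torsionOrder) :
    Summit.BirchSwinnertonDyer.BirchSwinnertonDyer.Theses.ClassRecordThree.EulerHalvesAtThree := by
  unfold Summit.BirchSwinnertonDyer.BirchSwinnertonDyer.Theses.ClassRecordThree.EulerHalvesAtThree
  intro W _ _ hX
  refine ⟨fun hram _ ↦ ?_, fun hram _ _ _ ↦ ?_, fun hρ _ ↦ ?_⟩
  · exact missingUpperBoundAt_three_of_classX11b_of_ram_of_coStepL hGZ hKo hSk hGZK hmod hnf hHL hMaz hPT hPT2 hco
      W hX hram
  · exact missingUpperBoundAt_three_of_classX11b_of_ram_of_coStepL hGZ hKo hSk hGZK hmod hnf hHL hMaz hPT hPT2 hco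
      W hX hram
  · exact missingUpperBoundAt_three_of_classX11b_of_surj_of_not_ram_of_coStepL_of_twistLower hGZ hKo hGZK hmod hnf
      hHL hMaz hPT hPT2 hco hTL W hX hρ

/-- **The shared decl of route `KolyvaginRoadThree` (same statement) from the same inputs.** [folklore] -/
theorem kolyvaginRoadThree_eulerHalvesAtThree_of_coStepL_of_twistLower
    (hGZ : ∀ (N : ℕ) [NeZero N] (W : WeierstrassCurve ℚ) (K : Type) [Field K] [NumberField K],
      gross_zagier N W K)
    (hKo : ∀ (N : ℕ) [NeZero N] (W : WeierstrassCurve ℚ) (K : Type) [Field K] [NumberField K],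
      kolyvagin N W K)
    (hSk : Skinner2016.thmC_padicValRat_bsd_rank_zero)
    (hGZK : rank_eq_analyticRank_of_analyticRank_le_one) (hmod : hasEntireLFunction_rat)
    (hnf : exists_isNewformOf) (hHL : HoffsteinLuo1997_exists_twist_L_one_ne_zero)
    (hMaz : mazur_not_dvd_maninConstant_of_odd)
    (hPT : ∀ (K : Type) [Field K] [NumberField K], poitouTate_selmerStructure_duality K)
    (hPT2 : ∀ (K : Type) [Field K] [NumberField K], poitouTate_sha_tateDual K)
    (hco : ∀ (W : WeierstrassCurve ℚ) [W.IsElliptic] [W.IsGloballyMinimal]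
      (N : ℕ) [NeZero N] (K : Type) [Field K] [NumberField K]
      (Dt : ModularParametrizationData W N) (H : HeegnerDatum N (NumberField.discr K)) (ι : K →+* ℂ)
      (P : (W.baseChange K).toAffine.Point),
      ClassX11b W 3 → Surj W 3 → W.conductorNorm ℤ = N → IsImaginaryQuadratic K →
      Odd (NumberField.discr K) → SatisfiesHeegnerHypothesis N K →
      (W.quadraticTwist (NumberField.discr K : ℚ)).entireLFunction 1 ≠ 0 →
      WeierstrassCurve.Affine.Point.map ι.toRatAlgHom P = heegnerPointComplex Dt H →
      ¬ (3 : ℤ) ∣ Dt.c → ¬ IsOfFinAddOrder P →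
      ∀ (κ : ZpExtension K 3), κ.IsAnticyclotomic →
        ∀ (γ : Field.absoluteGaloisGroup K) [Fact (κ.IsTopGenerator γ)]
          (𝔭 : HeightOneSpectrum (𝓞 K)) (h𝔭 : ((3 : ℕ) : 𝓞 K) ∈ 𝔭.asIdeal)
          (he : 𝔭.asIdeal.ramificationIdx (𝓞 ℚ) = 1) (hf : 𝔭.asIdeal.inertiaDeg (𝓞 ℚ) = 1),
          IMCUpperWaldspurgerOnTreeAt 3 κ 𝔭 γ (embAt K 3 𝔭 h𝔭 he hf) P)
    (hTL : ∀ (V : WeierstrassCurve ℚ) [V.IsElliptic] [V.IsGloballyMinimal],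
      V.HasMultiplicativeReductionAtPrime 3 → V.HasIrreducibleModPGaloisRep 3 →
      V.entireLFunction 1 ≠ 0 → Finite V.sha →
      ∃ q : ℚ, V.entireLFunction 1 / (V.realPeriodRat : ℂ) = (q : ℂ) ∧
        padicValRat 3 q ≤ (padicValNat 3 V.shaOrder : ℤ) + padicValNat 3 V.tamagawaProduct -
          2 * padicValNat 3 V.torsionOrder) :
    Summit.BirchSwinnertonDyer.BirchSwinnertonDyer.Theses.KolyvaginRoadThree.EulerHalvesAtThree :=
  classRecordThree_eulerHalvesAtThree_of_coStepL_of_twistLower hGZ hKo hSk hGZK hmod hnf hHL hMaz hPT hPT2 hco hTL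

end Summit.BirchSwinnertonDyer.Rank1Residual.X11b.Three.Koly

end
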